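import Literature.NumberTheory.ModularForms.MerelLogSumIdentity
import HarnessLib

/-!
# The λ-adic Bernoulli criterion and its bridge to Merel's invariant

Two kernel-checked steps, both elementary, connecting a cyclotomic-integer valuation condition to
Merel's number `∏_{k=1}^{(N−1)/2} k^k (mod N)`.

**(E2) — the λ-adic criterion in `ℤ[ζ_{p^{k+1}}]`.** Ring-theoretic core: for `ζ = 1 + π`,
`Σ ζ^{m i} c i = Σ c i + π·Σ (m i) c i + π²·r`; hence with `Σ c i ∈ (π²)` and `π` a
non-zero-divisor, `Σ ζ^{m i} c i ∈ (π²) ↔ Σ (m i) c i ∈ (π)`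
(`sum_pow_mul_mem_span_sq_iff_sum_mem_span`). Cyclotomic dictionary (`cyclotomic_criterion`):
`K = ℚ(ζ)`, `ζ` a primitive `p^{k+1}`-th root of unity, `π = ζ − 1 ∈ 𝓞 K` is a prime element with
`(p) = (π)^{[K:ℚ]}` (so `p ∈ (π²)` as soon as `[K:ℚ] ≥ 2`) and `π ∣ n ↔ p ∣ n` for `n ∈ ℤ` — all
three are Mathlib theorems (`IsCyclotomicExtension.Rat.map_eq_span_zeta_sub_one_pow`,
`IsPrimitiveRoot.zeta_sub_one_prime`, `IsCyclotomicExtension.Rat.zeta_sub_one_dvd_intCast_iff`);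
for integers `c i` with `p ∣ Σ c i` and exponents `m i`: `Σ ζ^{m i} c i ∈ (π²) ↔ p ∣ Σ (m i) c i`.

**BRIDGE ((E1)+(E2)) — `bernoulli_merel_bridge`.** With `c_a = a² − N a` (`N = 2h + 1`, `l ∣ N − 1`,
`l ∉ {2,3}`) and `ζ^{m a} = ε(a)` for exponents `m` whose reduction `log = m mod l` is
multiplicative on nonzero residues with `log(−1) = 0`:
`Σ_{a=1}^{N−1} ζ^{m a}(a² − N a) ∈ (π²) ↔ l ∣ Σ_{k=1}^{h} k·m k`, using the (E1) identity
`3·Σ_{a<N}(a² − N a) log a = −4·Σ_{k≤h} k log k` of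
`Literature/NumberTheory/ModularForms/MerelLogSumIdentity.lean` (`MerelLogSum.…`).
All PROVED here; axioms `propext`, `Classical.choice`, `Quot.sound`. `N` need not be prime.

Context (what is PRINTED). For a Dirichlet character `χ` mod `N`, the generalized Bernoulli
number is `B_{k,χ} = N^{k−1} Σ_{a=0}^{N−1} χ(a) B_k(⟨a/N⟩)` [Lang1990, Ch. 2 §2, formula **B 7**,
verbatim: «B_{k,f} = N^{k−1} Σ_{a=0}^{N−1} f(a) 𝐁_k(⟨a/N⟩)»], so for `χ ≠ 1` and `k = 2`
(`B₂(x) = x² − x + 1/6`, `Σ χ(a) = 0`): `N·B_{2,χ} = Σ_{a=1}^{N−1} χ(a)(a² − N a)` — the left side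
of the bridge is `v_λ(N·B_{2,ε}) ≥ 2` for `ε(a) = ζ^{m a}`. The printed group-ring form of the same
statement is [WakeWangErickson2020] (Wake–Wang-Erickson, *The rank of Mazur's Eisenstein ideal*,
Duke Math. J. 169 (2020)) §1.5 and §12: with `G = (ℤ/N)^×`, `I_G ⊂ ℤ/p^s[G]` the augmentation
ideal and «ζ = Σ_{i ∈ (ℤ/Nℤ)^×} B₂(⌊i/N⌋)[i] ∈ ℤ/p^sℤ[G], where B₂(x) = x² − x + 1/6»,
Lemma 12.3.1 (verbatim): «The following are equivalent: (1) Merel's number is a p^s-th power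
modulo N (2) ord_s ζ ≥ 2», proved via «I_G/I_G² ≅ G ⊗_ℤ ℤ/p^sℤ →(log) ℤ/p^sℤ sending [g] − 1 ∈ I_G
to log(g) … ζ (mod I_G²) gets sent to Σ_{i=1}^{N−1} (i² − i + 1/6) log(i). One sees easily that
Σ log(i) and Σ i log(i) are both 0 … Then ord_s ζ ≥ 2 if and only if Σ_{i=1}^{N−1} i² log(i) = 0.
The lemma now follows from Lemma 12.2.1» where Lemma 12.2.1 = [Lec16, Lem. 11] reads
«Σ_{i=1}^{N−1} i² log(i) = −(4/3) Σ_{i=1}^{(N−1)/2} i log(i)»; and Theorem 12.5.1 ((3) ⟺ (4),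
with the cup-product conditions (1), (2)). Merel's invariant itself: [Merel1996, Théorème 2]
(J. reine angew. Math. 477 (1996), p. 72, verbatim): «lorsque q > 3, [𝐓_𝔮 ≅ ℤ_q] si et seulement
si ∏_{l=1}^{(p−1)/2} l^l n'est pas une puissance q-ième de ℤ/pℤ» (restated
[Lecouturier2020, Thm 1.1], [WakeWangErickson2020, Thm 1.5.1]). Evaluating `ℤ/p^s[G]` at the
character `ε : [g] ↦ ζ^{m g}` sends `I_G` into `(π)` and `ζ` to `(1/N)·Σ ε(a)(a² − N a) + const·Σ ε(a)`,
which is how the present cyclotomic-integer statement and the printed group-ring statement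
correspond; the file proves the cyclotomic-integer statement directly and does not formalize
`B_{2,χ}`, `L(−1,χ)`, Hecke algebras or the Eisenstein ideal.

USE (why it is here): this is the step marked (E2) + "(E1)+(E2) bridge" in the venture cell
`pub-abcsig`'s derivation sheet lit/FLIP-DERIVATION-T1.md §2, identifying the cell's computed
`B_{2,ε}`-valuation criterion with Merel's invariant (hence, by [Merel1996, Thm 2], with
`rank_{ℤ_l} 𝐓_𝔮 ≥ 2`). Honest framing: elementary algebra in cyclotomic integers; no modular
forms, no statement about ABC. Authored by the cell's prover seat p1 (g9), 2026-08-23 (its files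
`MerelE2.lean` / `MerelBridge.lean`, namespaces `MerelE2`, `MerelBridge`); carried into
`Literature/` with statements and proofs unchanged (module docstring, namespace, the references to
the already-carried (E1) file, and citation tags by the literature seat).
-/

namespace Literature.NumberTheory.ModularForms

namespace MerelBernoulli

open Finset

variable {R : Type*} [CommRing R]

/-- First-order binomial expansion: `(1 + π)^m = 1 + m·π + π²·r` for some `r`. Elementary; proved
here (plumbing for (E2)). [cite: WakeWangErickson2020, Lemma 12.3.1 (proof: «[g] − 1 ∈ I_G … I_G/I_G² ≅ G ⊗ ℤ/p^s» — the group-ring form of the same first-order expansion; plumbing)] -/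
lemma exists_one_add_pow_eq (π : R) (m : ℕ) : ∃ r : R, (1 + π) ^ m = 1 + (m : R) * π + π ^ 2 * r := by
  induction m with
  | zero => exact ⟨0, by simp⟩
  | succ m ih =>
      obtain ⟨r, hr⟩ := ih
      refine ⟨r + (m : R) + π * r, ?_⟩
      rw [pow_succ, hr]
      push_cast
      ring

/-- First-order expansion of a twisted sum: `Σ (1+π)^{m i} c i = Σ c i + π·Σ (m i) c i + π²·r`.
Elementary; proved here (plumbing for (E2)). [cite: WakeWangErickson2020, Lemma 12.3.1 (proof: ζ mod I_G² ↦ Σ (i² − i + 1/6) log i; plumbing)] -/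
lemma exists_sum_pow_mul_eq {ι : Type*} (s : Finset ι) (π : R) (m : ι → ℕ) (c : ι → R) :
    ∃ r : R, ∑ i ∈ s, (1 + π) ^ (m i) * c i =
      ∑ i ∈ s, c i + π * ∑ i ∈ s, (m i : R) * c i + π ^ 2 * r := by
  classical
  induction s using Finset.induction_on with
  | empty => exact ⟨0, by simp⟩
  | insert a s ha ih =>
      obtain ⟨r, hr⟩ := ih
      obtain ⟨r₁, hr₁⟩ := exists_one_add_pow_eq π (m a)
      refine ⟨r + r₁ * c a, ?_⟩
      rw [sum_insert ha, sum_insert ha, sum_insert ha, hr, hr₁]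
      ring

/-- If `Σ c i ∈ (π²)` then `Σ (1+π)^{m i} c i ∈ (π²) ↔ π·Σ (m i) c i ∈ (π²)`. Elementary; proved
here. [cite: WakeWangErickson2020, Lemma 12.3.1 (proof; the (π²)-form of «ord_s ζ ≥ 2»)] -/
theorem sum_pow_mul_mem_span_sq_iff {ι : Type*} (s : Finset ι) (π : R) (m : ι → ℕ) (c : ι → R)
    (hc : ∑ i ∈ s, c i ∈ Ideal.span {π ^ 2}) :
    ∑ i ∈ s, (1 + π) ^ (m i) * c i ∈ Ideal.span {π ^ 2} ↔
      π * ∑ i ∈ s, (m i : R) * c i ∈ Ideal.span {π ^ 2} := by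
  obtain ⟨r, hr⟩ := exists_sum_pow_mul_eq s π m c
  have hr2 : π ^ 2 * r ∈ Ideal.span {π ^ 2} := Ideal.mul_mem_right _ _ (Ideal.mem_span_singleton_self _)
  rw [hr]
  constructor
  · intro h
    have key := Ideal.sub_mem _ (Ideal.sub_mem _ h hc) hr2
    have e : ∑ i ∈ s, c i + π * ∑ i ∈ s, (m i : R) * c i + π ^ 2 * r - ∑ i ∈ s, c i - π ^ 2 * r
        = π * ∑ i ∈ s, (m i : R) * c i := by ring
    rwa [e] at key
  · intro h
    exact Ideal.add_mem _ (Ideal.add_mem _ hc h) hr2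

/-- For a non-zero-divisor `π`: `π·x ∈ (π²) ↔ x ∈ (π)`. Elementary ring plumbing; proved here.
[cite: WakeWangErickson2020, Lemma 12.3.1 (proof; plumbing)] -/
theorem mul_mem_span_sq_iff (π x : R) (hπ : IsRegular π) :
    π * x ∈ Ideal.span {π ^ 2} ↔ x ∈ Ideal.span {π} := by
  rw [Ideal.mem_span_singleton, Ideal.mem_span_singleton]
  constructor
  · rintro ⟨y, hy⟩
    refine ⟨y, hπ.left ?_⟩
    show π * x = π * (π * y)
    rw [hy]; ring
  · rintro ⟨y, hy⟩
    exact ⟨y, by rw [hy]; ring⟩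

/-- **(E2), ring-theoretic core**: with `Σ c i ∈ (π²)` and `π` a non-zero-divisor,
`Σ (1+π)^{m i} c i ∈ (π²) ↔ Σ (m i) c i ∈ (π)`. Proved here; this is the abstract form of the
step «ζ (mod I_G²) gets sent to Σ (i² − i + 1/6) log(i)» of
[cite: WakeWangErickson2020, Lemma 12.3.1 (proof, p. 60: I_G/I_G² ≅ G ⊗ ℤ/p^s ≅ ℤ/p^s via log)], read
after evaluating the group ring at a character (`[g] ↦ ζ^{m g} = (1+π)^{m g}`, `I_G ↦ (π)`). -/
theorem sum_pow_mul_mem_span_sq_iff_sum_mem_span {ι : Type*} (s : Finset ι) (π : R) (hπ : IsRegular π)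
    (m : ι → ℕ) (c : ι → R) (hc : ∑ i ∈ s, c i ∈ Ideal.span {π ^ 2}) :
    ∑ i ∈ s, (1 + π) ^ (m i) * c i ∈ Ideal.span {π ^ 2} ↔
      ∑ i ∈ s, (m i : R) * c i ∈ Ideal.span {π} := by
  rw [sum_pow_mul_mem_span_sq_iff s π m c hc, mul_mem_span_sq_iff π _ hπ]

open NumberField in
/-- **(E2), cyclotomic form.** `K = ℚ(ζ)`, `ζ` a primitive `p^{k+1}`-th root of unity with
`[K : ℚ] ≥ 2`, `π = ζ − 1 ∈ 𝓞 K`; for integers `c i` with `p ∣ Σ c i` and exponents `m i`: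
`Σ ζ^{m i} c i ∈ (π²) ↔ (p : ℤ) ∣ Σ (m i) c i`. Proved here from the core and Mathlib's cyclotomic
dictionary (`IsCyclotomicExtension.Rat.map_eq_span_zeta_sub_one_pow`: `(p) = (ζ − 1)^{[K:ℚ]}`;
`IsPrimitiveRoot.zeta_sub_one_prime`; `IsCyclotomicExtension.Rat.zeta_sub_one_dvd_intCast_iff`:
`ζ − 1 ∣ n ↔ p ∣ n`; compare [cite: Lang1990, Ch. 2 §2 (generalized Bernoulli numbers B_{k,χ}, formula B 7) and Ch. 1 (ℤ[ζ] and the prime 1 − ζ)]).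
With `c_a = a² − N a`, `ζ^{m a} = ε(a)` this is `v_λ(N·B_{2,ε}) ≥ 2 ⟺ p ∣ Σ_a (a² − N a)·log a`, the
character-evaluated form of [cite: WakeWangErickson2020, Lemma 12.3.1 («(1) Merel's number is a p^s-th power modulo N ⟺ (2) ord_s ζ ≥ 2», proof via Σ (i² − i + 1/6) log i)]. -/
theorem cyclotomic_criterion {p k : ℕ} [hp : Fact p.Prime] {K : Type*} [Field K] [NumberField K]
    [IsCyclotomicExtension {p ^ (k + 1)} ℚ K] {ζ : K} (hζ : IsPrimitiveRoot ζ (p ^ (k + 1)))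
    (hK2 : 2 ≤ Module.finrank ℚ K)
    {ι : Type*} (s : Finset ι) (m : ι → ℕ) (c : ι → ℤ) (hc : (p : ℤ) ∣ ∑ i ∈ s, c i) :
    ∑ i ∈ s, (hζ.toInteger) ^ (m i) * (c i : 𝓞 K) ∈ Ideal.span {(hζ.toInteger - 1) ^ 2} ↔
      (p : ℤ) ∣ ∑ i ∈ s, (m i : ℤ) * c i := by
  set π : 𝓞 K := hζ.toInteger - 1 with hπdef
  have hζπ : hζ.toInteger = 1 + π := by rw [hπdef]; ring
  -- p ∈ (π²)
  have hpmem : ((p : ℤ) : 𝓞 K) ∈ Ideal.span {π ^ 2} := by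
    have h1 : ((p : ℤ) : 𝓞 K) ∈ Ideal.map (algebraMap ℤ (𝓞 K)) (Ideal.span {(p : ℤ)}) :=
      Ideal.mem_map_of_mem _ (Ideal.mem_span_singleton_self _)
    rw [IsCyclotomicExtension.Rat.map_eq_span_zeta_sub_one_pow p k hζ, Ideal.span_singleton_pow] at h1
    exact (Ideal.pow_le_pow_right hK2 : Ideal.span {π} ^ Module.finrank ℚ K ≤ Ideal.span {π} ^ 2)
      (by simpa [Ideal.span_singleton_pow] using h1) |> fun h => by simpa [Ideal.span_singleton_pow] using h
  -- Σ c i ∈ (π²)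
  have hcmem : ∑ i ∈ s, (c i : 𝓞 K) ∈ Ideal.span {π ^ 2} := by
    obtain ⟨d, hd⟩ := hc
    have : ∑ i ∈ s, (c i : 𝓞 K) = ((p : ℤ) : 𝓞 K) * (d : 𝓞 K) := by
      rw [← Int.cast_sum, hd]; push_cast; ring
    rw [this]; exact Ideal.mul_mem_right _ _ hpmem
  have hπreg : IsRegular π := by
    refine IsRegular.of_ne_zero ?_   -- 𝓞 K is a domain
    exact hζ.zeta_sub_one_prime.ne_zero
  have key := sum_pow_mul_mem_span_sq_iff_sum_mem_span s π hπreg m (fun i => (c i : 𝓞 K)) hcmem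
  simp only [← hζπ] at key
  rw [key, Ideal.mem_span_singleton]
  have hcast : ∑ i ∈ s, (m i : 𝓞 K) * (c i : 𝓞 K) = ((∑ i ∈ s, (m i : ℤ) * c i : ℤ) : 𝓞 K) := by
    push_cast; rfl
  rw [hcast]
  exact IsCyclotomicExtension.Rat.zeta_sub_one_dvd_intCast_iff p k hζ

open NumberField

/-- `l ∣ Σ_{a=1}^{2h} (a² − N a)` for `N = 2h + 1`, `l ∣ N − 1`, `l` prime `∉ {2, 3}` (the sum is
`−2h(h+1)(2h+1)/3` and `l ∣ h`) — the «ζ ∈ I_G» / trivial-character part. Elementary; proved here.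
[cite: WakeWangErickson2020, Lemma 12.3.1 (proof: «ζ ∈ I_G because s ≤ t = v_p(N−1)» and «Σ log(i), Σ i log(i) are both 0»)] -/
lemma dvd_sum_sq_sub {l : ℕ} (hl : l.Prime) (hl2 : l ≠ 2) (hl3 : l ≠ 3) {N h : ℕ} (hN : N = 2 * h + 1)
    (hlN : l ∣ N - 1) :
    (l : ℤ) ∣ ∑ a ∈ range (2 * h), (((a : ℤ) + 1) ^ 2 - (N : ℤ) * ((a : ℤ) + 1)) := by
  -- 6 · Σ = -4 h (h+1) (2h+1)
  have h6 : (6 : ℤ) * ∑ a ∈ range (2 * h), (((a : ℤ) + 1) ^ 2 - (N : ℤ) * ((a : ℤ) + 1)) =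
      -4 * h * (h + 1) * (2 * h + 1) := by
    have e1 := congrArg (Nat.cast : ℕ → ℤ) (MerelLogSum.six_mul_sum_sq (2 * h))
    have e2 := congrArg (Nat.cast : ℕ → ℤ) (MerelLogSum.two_mul_sum (2 * h))
    push_cast at e1 e2
    rw [Finset.mul_sum] at e1 e2 ⊢
    have : ∑ a ∈ range (2 * h), (6 : ℤ) * (((a : ℤ) + 1) ^ 2 - (N : ℤ) * ((a : ℤ) + 1)) =
        ∑ a ∈ range (2 * h), 6 * ((a : ℤ) + 1) ^ 2 - 3 * (N : ℤ) * ∑ a ∈ range (2 * h), 2 * ((a : ℤ) + 1) := by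
      rw [Finset.mul_sum, ← Finset.sum_sub_distrib]
      exact Finset.sum_congr rfl fun a _ => by ring
    rw [this, e1, e2, hN]; push_cast; ring
  have hlh : (l : ℤ) ∣ (h : ℤ) := by
    have h2h : l ∣ 2 * h := by simpa [hN] using hlN
    rcases (Nat.Prime.dvd_mul hl).mp h2h with h2 | hh
    · exact absurd ((Nat.prime_dvd_prime_iff_eq hl Nat.prime_two).mp h2) hl2
    · exact_mod_cast hh
  have hl6 : (l : ℤ) ∣ 6 * ∑ a ∈ range (2 * h), (((a : ℤ) + 1) ^ 2 - (N : ℤ) * ((a : ℤ) + 1)) := by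
    rw [h6]
    exact Dvd.dvd.mul_right (Dvd.dvd.mul_right (Dvd.dvd.mul_left hlh _) _) _
  have hlp : Prime (l : ℤ) := Nat.prime_iff_prime_int.mp hl
  rcases hlp.dvd_or_dvd hl6 with h6' | hs
  · exfalso
    have : l ∣ 6 := by exact_mod_cast h6'
    have : l ∣ 2 * 3 := by simpa using this
    rcases (Nat.Prime.dvd_mul hl).mp this with h2 | h3
    · exact hl2 ((Nat.prime_dvd_prime_iff_eq hl Nat.prime_two).mp h2)
    · exact hl3 ((Nat.prime_dvd_prime_iff_eq hl Nat.prime_three).mp h3)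
  · exact hs

/-- **§2 BRIDGE ((E1)+(E2)) — Bernoulli valuation criterion = Merel's invariant.** In
`𝓞(ℚ(ζ_{l^{k+1}}))` with `π = ζ − 1`, for `N = 2h+1`, `l ∣ N − 1`, `l ∉ {2,3}` prime,
`[K:ℚ] ≥ 2`, and exponents `m : ℕ → ℕ` whose reduction `log` mod `l` is multiplicative on the
nonzero residues mod `N` with `log(−1) = 0` (so `ε(a) = ζ^{m a}` is an even character of
`l`-power order when `log` is a homomorphism):
`Σ_{a=1}^{N−1} ζ^{m a}·(a² − N a) ∈ (π²)  ↔  (l : ℤ) ∣ Σ_{j=1}^{h} j · m j`.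
The left side is `v_λ(N·B_{2,ε}) ≥ 2` by `B_{2,ε} = N Σ_{a=0}^{N−1} ε(a) B₂(a/N)`,
`B₂(x) = x² − x + 1/6` [cite: Lang1990, Ch. 2 §2, formula B 7 («B_{k,f} = N^{k−1} Σ_{a=0}^{N−1} f(a) B_k(⟨a/N⟩)»)]
(`Σ ε(a) = 0` kills the constant); the right side is the vanishing mod `l` of the logarithm of
Merel's number `∏_{k=1}^{(N−1)/2} k^k` [cite: Merel1996, Thm 2 (p. 72: «∏_{l=1}^{(p−1)/2} l^l n'est pas une puissance q-ième de ℤ/pℤ» ⟺ 𝐓_𝔮 ≇ ℤ_q)].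
PROVED here by combining `cyclotomic_criterion` (E2) with the (E1) identity
`MerelLogSum.three_mul_sum_sq_sub_lin_log` (`3·Σ_{a<N}(a² − N a) log a = −4·Σ_{k≤h} k log k`);
it is the character-evaluated counterpart of the printed group-ring statement
[cite: WakeWangErickson2020, Lemma 12.3.1 with Lemma 12.2.1 («Σ_{i=1}^{N−1} i² log(i) = −(4/3) Σ_{i=1}^{(N−1)/2} i log(i)», = [Lec16, Lem. 11])]
and of [cite: WakeWangErickson2020, Thm 12.5.1 ((3) Merel's number is a p^s-th power modulo N ⟺ (4) ord_s(ζ) ≥ 2)].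
`N` need not be prime here (only odd with `l ∣ N − 1`). -/
theorem bernoulli_merel_bridge {l : ℕ} [hlF : Fact l.Prime] (hl2 : l ≠ 2) (hl3 : l ≠ 3)
    {N h : ℕ} (hN : N = 2 * h + 1) (hlN : l ∣ N - 1)
    {k : ℕ} {K : Type*} [Field K] [NumberField K] [IsCyclotomicExtension {l ^ (k + 1)} ℚ K] {ζ : K}
    (hζ : IsPrimitiveRoot ζ (l ^ (k + 1))) (hK2 : 2 ≤ Module.finrank ℚ K)
    (m : ℕ → ℕ) (log : ZMod N → ZMod l) (hm : ∀ a : ℕ, ((m a : ℕ) : ZMod l) = log ((a : ℕ) : ZMod N))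
    (hmul : ∀ a b : ZMod N, a ≠ 0 → b ≠ 0 → log (a * b) = log a + log b) (hneg : log (-1) = 0) :
    ∑ a ∈ range (2 * h), (hζ.toInteger) ^ (m (a + 1)) *
        ((((a : ℤ) + 1) ^ 2 - (N : ℤ) * ((a : ℤ) + 1) : ℤ) : 𝓞 K) ∈ Ideal.span {(hζ.toInteger - 1) ^ 2} ↔
      (l : ℤ) ∣ ∑ j ∈ range h, ((j : ℤ) + 1) * (m (j + 1) : ℤ) := by
  have hl : l.Prime := hlF.out
  -- (E2): membership ↔ l ∣ Σ m(a+1) · c(a)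
  have hc := dvd_sum_sq_sub hl hl2 hl3 hN hlN
  rw [cyclotomic_criterion hζ hK2 (range (2 * h)) (fun a => m (a + 1))
    (fun a => ((a : ℤ) + 1) ^ 2 - (N : ℤ) * ((a : ℤ) + 1)) hc]
  -- both divisibilities as vanishing in ZMod l
  rw [← ZMod.intCast_zmod_eq_zero_iff_dvd, ← ZMod.intCast_zmod_eq_zero_iff_dvd]
  push_cast
  -- (E1), second form
  have hN1 : (N : ZMod l) = 1 := by
    have h1 : 1 ≤ N := by omega
    have : ((N - 1 : ℕ) : ZMod l) = 0 := (ZMod.natCast_eq_zero_iff _ _).mpr hlN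
    rw [Nat.cast_sub h1, sub_eq_zero] at this
    exact_mod_cast this
  have e1 := MerelLogSum.three_mul_sum_sq_sub_lin_log hl2 hl3 hN hN1 log hmul hneg
  -- rewrite the two sums of e1 into the present shape
  have lhs_eq : ∑ a ∈ range (2 * h), ((m (a + 1) : ℕ) : ZMod l) * (((a : ZMod l) + 1) ^ 2 - (N : ZMod l) * ((a : ZMod l) + 1)) =
      ∑ c ∈ range (2 * h), (((c + 1 : ℕ) : ZMod l) ^ 2 - (N : ZMod l) * ((c + 1 : ℕ) : ZMod l)) *
        log ((c + 1 : ℕ) : ZMod N) := by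
    refine Finset.sum_congr rfl fun a _ => ?_
    rw [hm (a + 1)]; push_cast; ring
  have rhs_eq : ∑ j ∈ range h, ((j : ZMod l) + 1) * ((m (j + 1) : ℕ) : ZMod l) =
      ∑ k ∈ range h, ((k + 1 : ℕ) : ZMod l) * log ((k + 1 : ℕ) : ZMod N) := by
    refine Finset.sum_congr rfl fun j _ => ?_
    rw [hm (j + 1)]; push_cast; ring
  have h3 : (3 : ZMod l) ≠ 0 := by
    intro h0
    have : ((3 : ℕ) : ZMod l) = 0 := by exact_mod_cast h0
    rw [ZMod.natCast_eq_zero_iff] at this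
    exact hl3 ((Nat.prime_dvd_prime_iff_eq hl Nat.prime_three).mp this)
  have h4 : (4 : ZMod l) ≠ 0 := by
    intro h0
    have : ((4 : ℕ) : ZMod l) = 0 := by exact_mod_cast h0
    rw [ZMod.natCast_eq_zero_iff] at this
    have : l ∣ 2 * 2 := by simpa using this
    rcases (Nat.Prime.dvd_mul hl).mp this with h2 | h2 <;>
      exact hl2 ((Nat.prime_dvd_prime_iff_eq hl Nat.prime_two).mp h2)
  rw [lhs_eq, rhs_eq]
  constructor
  · intro h0
    have : (-4 : ZMod l) * ∑ k ∈ range h, ((k + 1 : ℕ) : ZMod l) * log ((k + 1 : ℕ) : ZMod N) = 0 := by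
      rw [← e1, h0, mul_zero]
    rcases mul_eq_zero.mp this with h4' | hs
    · exact absurd (neg_eq_zero.mp h4') h4
    · exact hs
  · intro h0
    have : (3 : ZMod l) * ∑ c ∈ range (2 * h), (((c + 1 : ℕ) : ZMod l) ^ 2 - (N : ZMod l) * ((c + 1 : ℕ) : ZMod l)) *
        log ((c + 1 : ℕ) : ZMod N) = 0 := by
      rw [e1, h0, mul_zero]
    rcases mul_eq_zero.mp this with h3' | hs
    · exact absurd h3' h3
    · exact hs

end MerelBernoulli

end Literature.NumberTheory.ModularForms
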